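import Mathlib.Algebra.Algebra.Bilinear
import Mathlib.Algebra.Algebra.Pi
import Mathlib.Algebra.Algebra.Prod
import Mathlib.Algebra.Algebra.Opposite
import Mathlib.Algebra.Module.Submodule.EqLocus
import Mathlib.LinearAlgebra.Trace
import Mathlib.LinearAlgebra.BilinearForm.Properties
import Mathlib.LinearAlgebra.TensorProduct.Tower
import Mathlib.RingTheory.TensorProduct.Basic
import Mathlib.RingTheory.SimpleModule.Basic
import Mathlib.RingTheory.SimpleRing.Basic
import Mathlib.RingTheory.TwoSidedIdeal.Lattice
import Mathlib.FieldTheory.IsAlgClosed.Basic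
import Mathlib.Analysis.Convex.Basic
import Mathlib.Topology.Algebra.Module.ModuleTopology
import Literature.NumberTheory.Automorphic.QuaternionAlgebraAdelic
import HarnessLib

/-!
# Kottwitz 1992, §1 «Involutions on semisimple algebras» and §2 «Positive involutions»
# (statement carpet: definitions with bodies + every numbered statement as a named fact)

R. E. Kottwitz, *Points on some Shimura varieties over finite fields*, J. Amer. Math. Soc. **5** (1992)
373–444 [Kottwitz1992], §1 (pp. 378–379) and §2 (pp. 379–382).  Held text `paper:doi-10-2307-2152772`
(pdf page `p00NN` = printed page `372 + NN`): §1 = p0006 L27 – p0007 L14, §2 = p0007 L15 – p0010 L44.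
Squad TK (HCML «GO 500»), typer TK-t01; target `Literature/NumberTheory/Kottwitz1992/Involutions.lean`,
namespace `Literature.NumberTheory.Kottwitz1992.Involutions`.  STATEMENTS ONLY (cell TYPER LINT RULE): every
numbered Lemma of §2 (2.1–2.11) is a named fact `def Kottwitz1992_2_<m>_<name> : Prop := …` carrying its
standing hypotheses explicitly; the notions the paper introduces and Mathlib lacks are `def`/`structure`s WITH
BODIES (no `sorry`, no `axiom`, no `instance`, no `notation`, no theorem).  Nothing here is proved; dischargers
append `theorem <name>_holds : <name> …` later (D-0014 append protocol).

## The print (verbatim, abridged) and the Lean rendering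

§1 (p. 378): «Let `B` be a finite-dimensional semisimple algebra over a field `F` of characteristic zero.  An
involution `*` on `B` is a linear isomorphism from `B` to itself such that `(xy)* = y* x*` and `x** = x`. …
Let `B_sym` denote the subspace of `B` consisting of elements that are fixed by the involution and let `B_sym^×`
denote the subset consisting of all elements of `B_sym` that are invertible in `B`.  The group `B^×` … acts on
`B_sym`, the action of an invertible element `b` of `B` being given by `x ↦ b x b*` … When `F` is algebraically
closed, the action is transitive on this subset … Let `G` denote the algebraic group whose points in any
algebra `R` over `F` are given by the set of elements `x` in `B ⊗_F R` such that `x x* = 1`.»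
  Lean: the involution is UNBUNDLED, an `F`-linear map `ι : B →ₗ[F] B` with `IsInvolution F B ι`
  (`ι (x y) = ι y * ι x`, `ι (ι x) = x`; bijectivity is a consequence and is not a field) — the convention of
  the tree's `ℝ`-algebra files `RingTheory/CentralSimple/PositiveInvolution*.lean`; for `F = ℚ` the two fields
  are literally those of the tree's `Literature.RingTheory.CentralSimple.IsAntiInvolution` (AlbertTypes.lean),
  which is `ℚ`-linear only and is therefore not reused but mirrored.  `symSubmodule`, `symUnits`, `unitsAct`,
  `unitaryPoints R` (= `G(R)` as a SET of `R ⊗_F B`; no group structure is asserted here).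

§2 (p. 379): «In this section `B` denotes a finite-dimensional semisimple algebra over `ℝ` with involution `*`.
By a `B`-module we mean finitely generated left `B`-module.  A Hermitian form on a `B`-module `V` is a
symmetric real-valued bilinear form `(v, w)` on `V` such that `(bv, w) = (v, b* w)` … positive definite if
`(v, v) > 0` for all nonzero `v ∈ V`.»
  Lean: the standing hypothesis is the `Prop`-structure `IsAlgebraWithInvolution B ι` (finite-dimensional over
  `ℝ`, `IsSemisimpleRing`, `IsInvolution`); a `B`-module is `[Module B V] [Module ℝ V] [IsScalarTower ℝ B V]
  [Module.Finite B V]`; forms are Mathlib's `LinearMap.BilinForm ℝ V`; `IsHermitianForm`,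
  `IsPosDefHermitianForm`; `tr(x ; V)` is `moduleTrace B V x` (Mathlib `LinearMap.trace` of `v ↦ x • v`) and
  `tr_{B/ℝ}` is the tree's `leftMulTrace ℝ B` (`Literature.NumberTheory.Automorphic`, = `LinearMap.trace ∘
  Algebra.lmul`).  «DEFINITION. An involution is said to be positive if it satisfies the equivalent conditions
  of Lemma 2.2» is rendered by condition (3), the intrinsic one: `IsPositiveInvolution B ι` := involution `∧`
  `tr_{B/ℝ}(x x*) > 0` for `x ≠ 0`; Lemma 2.2 is then the named fact that (1)–(5) are equivalent
  (`List.TFAE`).  `B`-modules quantified inside a fact range over the universe of `B`.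
  «`*` leaves stable a semisimple subalgebra `C` and induces …» (Lemmas 2.3 (3), 2.9) is rendered through an
  injective `ℝ`-algebra map `f : C →ₐ[ℝ] B` intertwining `ι_C` and `ι` (isomorphic reformulation: `C ≅ f(C)`).
  Topology in Lemma 2.8 («open … in `B_sym`») = the module topology of the finite-dimensional real vector space
  `B` (Mathlib `IsModuleTopology ℝ B`), restricted to the subtype `symSubmodule`.

DEDUP.  Nothing of §§1–2 was in the tree under this key (`rg 'Kottwitz1992, (§ ?2|Lemma 2\.)'` = ∅, TK-plan
DEDUP-Kottwitz.v1).  Related PROVED material cited instead of restated: Lange's Lemma 2.6.3 = the Remark closing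
§2 for SIMPLE `B` (`Literature.RingTheory.CentralSimple.exists_algEquiv_matrix_forall_apply_eq`,
PositiveInvolutionQuaternionMatrices.lean: a positive anti-involution of a finite-dimensional simple `ℝ`-algebra
is conjugate to `ᵗ`, `ᵗ‾` on `M_r(ℝ)`, `M_r(ℂ)`, `M_r(ℍ)`), Milne CM Prop. 1.36/1.39 over `ℚ`
(`Literature.NumberTheory.ComplexMultiplication.CMAlgebraPositiveInvolution`).  Kottwitz's Lemma 3.1 (§3) is the
tree's theorem `Literature.RingTheory.SimpleModule.isSemisimpleModule_of_forall_isSemisimpleRing_moduleEnd`.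

## References
* [Kottwitz1992] R. E. Kottwitz, Points on some Shimura varieties over finite fields, J. Amer. Math. Soc. 5
  (1992) 373–444, §1 pp. 378–379, §2 pp. 379–382 (Lemmas 2.1–2.11, two Definitions, Notation, Remark).
-/

noncomputable section

open TensorProduct
open Literature.NumberTheory.Automorphic (leftMulTrace)

namespace Literature.NumberTheory.Kottwitz1992.Involutions

universe u v

/-! ## §1  Involutions on semisimple algebras (p. 378–379) -/

section Involutions

variable (F : Type*) [Field F] (B : Type*) [Ring B] [Algebra F B]

/-- **Involution** of the `F`-algebra `B` (Kottwitz §1, p. 378: «a linear isomorphism from `B` to itself such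
that `(xy)* = y*x*` and `x** = x`»), unbundled as an `F`-linear map `ι` with the two printed identities
(bijectivity follows from `ι ∘ ι = id` and is not recorded).  For `F = ℚ` these are the two fields of the tree's
`Literature.RingTheory.CentralSimple.IsAntiInvolution`. [cite: Kottwitz1992, §1 (p. 378)] -/
structure IsInvolution (ι : B →ₗ[F] B) : Prop where
  /-- `(x y)* = y* x*`. -/
  map_mul : ∀ x y : B, ι (x * y) = ι y * ι x
  /-- `x** = x`. -/
  apply_apply : ∀ x : B, ι (ι x) = x

variable {F B}

/-- `B_sym`, «the subspace of `B` consisting of elements that are fixed by the involution» (p. 378), as an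
`F`-submodule: Mathlib's equaliser `LinearMap.eqLocus ι id = {x | ι x = x}`. [cite: Kottwitz1992, §1 (p. 378)] -/
def symSubmodule (ι : B →ₗ[F] B) : Submodule F B := LinearMap.eqLocus ι LinearMap.id

/-- `B_sym^×`, «the subset consisting of all elements of `B_sym` that are invertible in `B`» (p. 378), as a set
of units of `B`. [cite: Kottwitz1992, §1 (p. 378)] -/
def symUnits (ι : B →ₗ[F] B) : Set Bˣ := {b | ι (b : B) = b}

/-- The action of `B^×` on `B` (preserving `B_sym` and `B_sym^×`), «the action of an invertible element `b` of
`B` being given by `x ↦ b x b*`» (p. 379). [cite: Kottwitz1992, §1 (p. 379)] -/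
def unitsAct (ι : B →ₗ[F] B) (b : Bˣ) (x : B) : B := (b : B) * x * ι b

/-- `G(R) = {x ∈ B ⊗_F R | x x* = 1}` (p. 379: «Let `G` denote the algebraic group whose points in any algebra
`R` over `F` are given by the set of elements `x` in `B ⊗_F R` such that `x x* = 1`»), as the SET of such
points of the `R`-algebra `R ⊗_F B`, the involution extended `R`-linearly (`LinearMap.baseChange`).  Only the
points are recorded (no group-scheme structure). [cite: Kottwitz1992, §1 (p. 379)] -/
def unitaryPoints (ι : B →ₗ[F] B) (R : Type*) [CommRing R] [Algebra F R] : Set (R ⊗[F] B) :=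
  {x | x * (ι.baseChange R) x = 1}

/-- `(B, *)` is **irreducible** as an algebra with involution: `B ≠ 0` and the only `*`-stable two-sided ideals
are `0` and `B` (p. 378: «the algebra `B` with involution is a product of semisimple algebras with involution,
with each factor either simple or else the product of two simple algebras interchanged by `*` … we may as well
suppose that we are in one of these two irreducible cases»). [cite: Kottwitz1992, §1 (p. 378)] -/
def IsIrreducible (ι : B →ₗ[F] B) : Prop :=
  Nontrivial B ∧ ∀ I : TwoSidedIdeal B, (∀ x ∈ I, ι x ∈ I) → I = ⊥ ∨ I = ⊤

variable (F B)

/-- §1 CLASSIFICATION over an algebraically closed field (p. 378, unnumbered): for `F` algebraically closed of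
characteristic zero and `(B, *)` finite-dimensional semisimple and irreducible, EITHER «`B` is a matrix algebra
over `F` and … the pair consisting of `B` and `*` is isomorphic to the algebra of endomorphisms of a
finite-dimensional nondegenerate quadratic or symplectic vector space over `F` with involution given by the
adjoint map for the given bilinear form», OR «`B` is isomorphic to a product `M × M^opp` with involution given
by `(x, y) ↦ (y, x)`, where `M` is a matrix algebra».  (Adjoint for `φ`: `φ (e x v) w = φ v (e x* w)`, Mathlib
`LinearMap.IsAdjointPair φ φ (e x) (e x*)`.) [cite: Kottwitz1992, §1 (p. 378)] -/
def Kottwitz1992_1_irreducible_classification (ι : B →ₗ[F] B) : Prop :=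
  ∀ [IsAlgClosed F] [CharZero F] [FiniteDimensional F B] [IsSemisimpleRing B],
    IsInvolution F B ι → IsIrreducible ι →
      (∃ (n : ℕ) (φ : LinearMap.BilinForm F (Fin n → F)) (e : B ≃ₐ[F] Module.End F (Fin n → F)),
          φ.Nondegenerate ∧ (φ.IsSymm ∨ φ.IsAlt) ∧ ∀ x : B, LinearMap.IsAdjointPair φ φ (e x) (e (ι x))) ∨
      (∃ (n : ℕ) (e : B ≃ₐ[F] (Matrix (Fin n) (Fin n) F × (Matrix (Fin n) (Fin n) F)ᵐᵒᵖ)),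
          ∀ x : B, e (ι x) = (MulOpposite.unop (e x).2, MulOpposite.op (e x).1))

/-- §1 TRANSITIVITY (p. 379, unnumbered): «When `F` is algebraically closed, the action [`x ↦ b x b*` of `B^×`]
is transitive on this subset [`B_sym^×`], as one sees by examining the three irreducible cases … keeping in mind
that over an algebraically closed field of characteristic different from 2 any two nondegenerate symmetric
bilinear forms are equivalent.» [cite: Kottwitz1992, §1 (p. 379)] -/
def Kottwitz1992_1_unitsAct_transitive (ι : B →ₗ[F] B) : Prop :=
  ∀ [IsAlgClosed F] [CharZero F] [FiniteDimensional F B] [IsSemisimpleRing B],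
    IsInvolution F B ι → ∀ x ∈ symUnits ι, ∀ y ∈ symUnits ι, ∃ b : Bˣ, unitsAct ι b (x : B) = (y : B)

end Involutions

/-! ## §2  Positive involutions (p. 379–382): the carriers -/

section Carriers

variable (B : Type u) [Ring B] [Algebra ℝ B]

/-- The STANDING HYPOTHESIS of §2 (p. 379): «`B` denotes a finite-dimensional semisimple algebra over `ℝ` with
involution `*`» — recorded as one `Prop` so that every fact of §2 carries it explicitly.
[cite: Kottwitz1992, §2 (p. 379)] -/
structure IsAlgebraWithInvolution (ι : B →ₗ[ℝ] B) : Prop where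
  /-- `B` is finite-dimensional over `ℝ`. -/
  finiteDimensional : FiniteDimensional ℝ B
  /-- `B` is a semisimple ring. -/
  isSemisimpleRing : IsSemisimpleRing B
  /-- `*` is an involution. -/
  isInvolution : IsInvolution ℝ B ι

variable (V : Type v) [AddCommGroup V] [Module ℝ V] [Module B V] [IsScalarTower ℝ B V]

/-- **Hermitian form** on the `B`-module `V` for the involution `ι` (p. 379): «a symmetric real-valued bilinear
form `(v, w)` on `V` such that `(bv, w) = (v, b*w)` for all `b ∈ B` and all `v, w ∈ V`».
[cite: Kottwitz1992, §2 (p. 379)] -/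
structure IsHermitianForm (ι : B →ₗ[ℝ] B) (φ : LinearMap.BilinForm ℝ V) : Prop where
  /-- symmetric: `(v, w) = (w, v)`. -/
  symm : ∀ v w : V, φ v w = φ w v
  /-- `(b v, w) = (v, b* w)`. -/
  smul_left : ∀ (b : B) (v w : V), φ (b • v) w = φ v (ι b • w)

/-- **Positive definite Hermitian form** (p. 379: «We say that a Hermitian `B`-module is positive definite if
`(v, v) > 0` for all nonzero `v ∈ V`»); a *positive definite Hermitian `B`-module* is a pair `(V, φ)` with
`IsPosDefHermitianForm B V ι φ`. [cite: Kottwitz1992, §2 (p. 379)] -/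
def IsPosDefHermitianForm (ι : B →ₗ[ℝ] B) (φ : LinearMap.BilinForm ℝ V) : Prop :=
  IsHermitianForm B V ι φ ∧ ∀ v : V, v ≠ 0 → 0 < φ v v

/-- `tr(x ; V)`: the trace of the `ℝ`-linear endomorphism `v ↦ x • v` of the `B`-module `V` (p. 379, as in
«`tr(xx* ; V)`»): Mathlib's `LinearMap.trace ℝ V` of `DistribSMul.toLinearMap ℝ V x`. [cite: Kottwitz1992, §2 (p. 379)] -/
def moduleTrace (x : B) : ℝ := LinearMap.trace ℝ V (DistribSMul.toLinearMap ℝ V x)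

/-- **Positive involution** (p. 380, «DEFINITION. An involution is said to be positive if it satisfies the
equivalent conditions of Lemma 2.2»), rendered by condition (3) of Lemma 2.2: `*` is an involution and
`tr_{B/ℝ}(x x*) > 0` for all nonzero `x ∈ B` (`tr_{B/ℝ}` = the tree's `leftMulTrace ℝ B`).  The equivalence with
(1), (2), (4), (5) is the named fact `Kottwitz1992_2_2_tfae`. [cite: Kottwitz1992, §2 Definition (p. 380) and Lemma 2.2 (3) (p. 379)] -/
structure IsPositiveInvolution (ι : B →ₗ[ℝ] B) : Prop extends IsInvolution ℝ B ι where
  /-- `tr_{B/ℝ}(x x*) > 0` for `x ≠ 0`. -/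
  trace_mul_self_pos : ∀ x : B, x ≠ 0 → 0 < leftMulTrace ℝ B (x * ι x)

variable {B}

/-- NOTATION (p. 381): «For `b ∈ B` we write `(x, y)_b` for the bilinear form `(x, y)_b = tr_{B/ℝ} x b y*` on
`B`», as a real-valued function of `x, y`. [cite: Kottwitz1992, §2 Notation (p. 381)] -/
def trForm (ι : B →ₗ[ℝ] B) (b x y : B) : ℝ := leftMulTrace ℝ B (x * b * ι y)

/-- `B₊`, the **positive** elements (p. 381: «We say that a symmetric element `b` of `B` is positive if the form
`(x, y)_b` is positive definite.  We write `B₊` for the set of positive elements in `B_sym`»).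
[cite: Kottwitz1992, §2 Definition (p. 381)] -/
def posElts (ι : B →ₗ[ℝ] B) : Set B := {b | ι b = b ∧ ∀ x : B, x ≠ 0 → 0 < trForm ι b x x}

/-- A **`*`-homomorphism** `i : (B, *_B) → (C, *_C)` of `ℝ`-algebras with involution (p. 382: «an `ℝ`-algebra
homomorphism `i` from `B` to `C` is a `*`-homomorphism if `i(b*) = i(b)*` for all `b ∈ B`»).
[cite: Kottwitz1992, §2 (p. 382)] -/
def IsStarHom {C : Type*} [Ring C] [Algebra ℝ C] (ιB : B →ₗ[ℝ] B) (ιC : C →ₗ[ℝ] C) (i : B →ₐ[ℝ] C) :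
    Prop :=
  ∀ b : B, i (ιB b) = ιC (i b)

end Carriers

/-! ## §2  Positive involutions: the numbered statements (Lemmas 2.1–2.11) -/

section Facts

variable (B : Type u) [Ring B] [Algebra ℝ B] (ι : B →ₗ[ℝ] B)

/-- **Lemma 2.1** (p. 379): «Any positive definite Hermitian `B`-module `V` can be written as a direct sum of
positive definite Hermitian `B`-modules that are irreducible as `B`-modules.»  (Proof: induction on the length;
`V = W ⊕ W^⊥` for an irreducible submodule `W`.)  Rendered: an internal direct sum of finitely many pairwise
`φ`-orthogonal `B`-submodules, each a simple `B`-module (the restricted forms are then positive definite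
Hermitian). [cite: Kottwitz1992, Lemma 2.1 (p. 379)] -/
def Kottwitz1992_2_1_posDef_directSum_irreducible : Prop :=
  IsAlgebraWithInvolution B ι →
    ∀ (V : Type u) [AddCommGroup V] [Module ℝ V] [Module B V] [IsScalarTower ℝ B V] [Module.Finite B V]
      (φ : LinearMap.BilinForm ℝ V), IsPosDefHermitianForm B V ι φ →
      ∃ (n : ℕ) (W : Fin n → Submodule B V), DirectSum.IsInternal W ∧ (∀ i, IsSimpleModule B (W i)) ∧
        ∀ i j, i ≠ j → ∀ v ∈ W i, ∀ w ∈ W j, φ v w = 0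

/-- Lemma 2.2, condition (1): «Every `B`-module carries some positive definite Hermitian form.»
[cite: Kottwitz1992, Lemma 2.2 (1) (p. 379)] -/
def ExistsPosDefFormOnEveryModule : Prop :=
  ∀ (V : Type u) [AddCommGroup V] [Module ℝ V] [Module B V] [IsScalarTower ℝ B V] [Module.Finite B V],
    ∃ φ : LinearMap.BilinForm ℝ V, IsPosDefHermitianForm B V ι φ

/-- Lemma 2.2, condition (2): «For every faithful `B`-module `V` we have `tr(xx* ; V) > 0` for all nonzero
`x ∈ B`.» [cite: Kottwitz1992, Lemma 2.2 (2) (p. 379)] -/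
def TraceMulSelfPosOnEveryFaithfulModule : Prop :=
  ∀ (V : Type u) [AddCommGroup V] [Module ℝ V] [Module B V] [IsScalarTower ℝ B V] [Module.Finite B V]
    [FaithfulSMul B V], ∀ x : B, x ≠ 0 → 0 < moduleTrace B V (x * ι x)

/-- Lemma 2.2, condition (3): «`tr_{B/ℝ}(xx*) > 0` for all nonzero `x ∈ B`.»
[cite: Kottwitz1992, Lemma 2.2 (3) (p. 379)] -/
def TraceMulSelfPos : Prop :=
  ∀ x : B, x ≠ 0 → 0 < leftMulTrace ℝ B (x * ι x)

/-- Lemma 2.2, condition (4): «There exists a `B`-module `V` such that `tr(xx* ; V) > 0` for all nonzero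
`x ∈ B`.» [cite: Kottwitz1992, Lemma 2.2 (4) (p. 379)] -/
def ExistsModuleTraceMulSelfPos : Prop :=
  ∃ (V : Type u) (_ : AddCommGroup V) (_ : Module ℝ V) (_ : Module B V) (_ : IsScalarTower ℝ B V)
    (_ : Module.Finite B V), ∀ x : B, x ≠ 0 → 0 < moduleTrace B V (x * ι x)

/-- Lemma 2.2, condition (5): «There exists a faithful positive definite Hermitian `B`-module.»
[cite: Kottwitz1992, Lemma 2.2 (5) (p. 379)] -/
def ExistsFaithfulPosDefModule : Prop :=
  ∃ (V : Type u) (_ : AddCommGroup V) (_ : Module ℝ V) (_ : Module B V) (_ : IsScalarTower ℝ B V)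
    (_ : Module.Finite B V) (_ : FaithfulSMul B V) (φ : LinearMap.BilinForm ℝ V), IsPosDefHermitianForm B V ι φ

/-- **Lemma 2.2** (p. 379): «The following are equivalent conditions on the involution `*`.  (1) Every
`B`-module carries some positive definite Hermitian form.  (2) For every faithful `B`-module `V` we have
`tr(xx* ; V) > 0` for all nonzero `x ∈ B`.  (3) `tr_{B/ℝ}(xx*) > 0` for all nonzero `x ∈ B`.  (4) There exists
a `B`-module `V` such that `tr(xx* ; V) > 0` for all nonzero `x ∈ B`.  (5) There exists a faithful positive
definite Hermitian `B`-module.»  (`B`-modules = finitely generated, in the universe of `B`.)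
[cite: Kottwitz1992, Lemma 2.2 (p. 379)] -/
def Kottwitz1992_2_2_tfae : Prop :=
  IsAlgebraWithInvolution B ι →
    [ExistsPosDefFormOnEveryModule B ι, TraceMulSelfPosOnEveryFaithfulModule B ι, TraceMulSelfPos B ι,
      ExistsModuleTraceMulSelfPos B ι, ExistsFaithfulPosDefModule B ι].TFAE

/-- **Lemma 2.3 (1)** (p. 380): «If `*` is a positive involution of `B`, then it is also a positive involution
of `B^opp`» (the same map, read on `Bᵐᵒᵖ` through `MulOpposite.opLinearEquiv`).
[cite: Kottwitz1992, Lemma 2.3 (1) (p. 380)] -/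
def Kottwitz1992_2_3_1_op : Prop :=
  IsAlgebraWithInvolution B ι → IsPositiveInvolution B ι →
    IsPositiveInvolution Bᵐᵒᵖ
      ((MulOpposite.opLinearEquiv ℝ).toLinearMap ∘ₗ ι ∘ₗ (MulOpposite.opLinearEquiv ℝ (M := B)).symm.toLinearMap)

/-- **Lemma 2.3 (2)** (p. 380): «The tensor product (respectively, direct product) of positive involutions on
semisimple algebras `B₁` and `B₂` is a positive involution on `B₁ ⊗_ℝ B₂` (respectively, `B₁ × B₂`).»
[cite: Kottwitz1992, Lemma 2.3 (2) (p. 380)] -/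
def Kottwitz1992_2_3_2_tensor_prod (B₂ : Type u) [Ring B₂] [Algebra ℝ B₂] (ι₂ : B₂ →ₗ[ℝ] B₂) : Prop :=
  IsAlgebraWithInvolution B ι → IsAlgebraWithInvolution B₂ ι₂ →
    IsPositiveInvolution B ι → IsPositiveInvolution B₂ ι₂ →
      IsPositiveInvolution (B ⊗[ℝ] B₂) (TensorProduct.map ι ι₂) ∧
        IsPositiveInvolution (B × B₂) (ι.prodMap ι₂)

/-- **Lemma 2.3 (3)** (p. 380): «If `*` is a positive involution of `B` leaving stable a semisimple subalgebra
`C` of `B`, then `*` induces a positive involution of `C`.»  The stable subalgebra is presented by an injective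
`ℝ`-algebra map `f : C → B` with `f (ι_C c) = ι (f c)`. [cite: Kottwitz1992, Lemma 2.3 (3) (p. 380)] -/
def Kottwitz1992_2_3_3_subalgebra (C : Type u) [Ring C] [Algebra ℝ C] (ιC : C →ₗ[ℝ] C) (f : C →ₐ[ℝ] B) :
    Prop :=
  IsAlgebraWithInvolution B ι → IsPositiveInvolution B ι → IsSemisimpleRing C → Function.Injective f →
    (∀ c : C, f (ιC c) = ι (f c)) → IsPositiveInvolution C ιC

/-- **Lemma 2.4** (p. 380): «Let `*` be a positive involution of `B`.  Then `*` leaves stable each simple factor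
of `B`, and as an algebra with involution `B` is the direct product of simple algebras with positive
involution.»  First clause: every MINIMAL nonzero two-sided ideal (= simple factor) is `*`-stable; second clause:
an `ℝ`-algebra isomorphism `B ≅ ∏ᵢ Cᵢ` with each `Cᵢ` simple, carrying `*` to a positive involution on each
factor. [cite: Kottwitz1992, Lemma 2.4 (p. 380)] -/
def Kottwitz1992_2_4_product_of_simple : Prop :=
  IsAlgebraWithInvolution B ι → IsPositiveInvolution B ι →
    (∀ I : TwoSidedIdeal B, IsAtom I → ∀ x ∈ I, ι x ∈ I) ∧
    ∃ (n : ℕ) (C : Fin n → Type u) (_ : ∀ i, Ring (C i)) (_ : ∀ i, Algebra ℝ (C i))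
      (κ : ∀ i, C i →ₗ[ℝ] C i) (e : B ≃ₐ[ℝ] (∀ i, C i)),
      (∀ i, IsSimpleRing (C i)) ∧ (∀ i, IsPositiveInvolution (C i) (κ i)) ∧
        ∀ (x : B) (i : Fin n), e (ι x) i = κ i (e x i)

/-- **Lemma 2.5** (p. 380): «Let `B` be a finite-dimensional division algebra over `ℝ`, and suppose that `*` is a
positive involution of `B`.  Then `B_sym = ℝ`.» [cite: Kottwitz1992, Lemma 2.5 (p. 380)] -/
def Kottwitz1992_2_5_sym_eq_real (D : Type u) [DivisionRing D] [Algebra ℝ D] (κ : D →ₗ[ℝ] D) : Prop :=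
  FiniteDimensional ℝ D → IsPositiveInvolution D κ → {x : D | κ x = x} = Set.range (algebraMap ℝ D)

/-- **Lemma 2.6 (1)** (p. 380): «Suppose that `*` is a positive involution of `B`.  Let `V` be an irreducible
`B`-module.  Then the real vector space of Hermitian forms on `V` is one-dimensional» — rendered: there is a
nonzero Hermitian form `φ₀` on `V` and every Hermitian form is a real multiple of it.
[cite: Kottwitz1992, Lemma 2.6 (1) (p. 380)] -/
def Kottwitz1992_2_6_1_hermitianForms_rank_one : Prop :=
  IsAlgebraWithInvolution B ι → IsPositiveInvolution B ι →
    ∀ (V : Type u) [AddCommGroup V] [Module ℝ V] [Module B V] [IsScalarTower ℝ B V] [Module.Finite B V],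
      IsSimpleModule B V →
        ∃ φ₀ : LinearMap.BilinForm ℝ V, IsHermitianForm B V ι φ₀ ∧ φ₀ ≠ 0 ∧
          ∀ φ : LinearMap.BilinForm ℝ V, IsHermitianForm B V ι φ → ∃ r : ℝ, φ = r • φ₀

/-- **Lemma 2.6 (2)** (p. 380): «Two positive definite Hermitian `B`-modules are isomorphic as Hermitian
`B`-modules if and only if they are isomorphic as `B`-modules.» [cite: Kottwitz1992, Lemma 2.6 (2) (p. 380)] -/
def Kottwitz1992_2_6_2_iso_iff : Prop :=
  IsAlgebraWithInvolution B ι → IsPositiveInvolution B ι →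
    ∀ (V₁ : Type u) [AddCommGroup V₁] [Module ℝ V₁] [Module B V₁] [IsScalarTower ℝ B V₁] [Module.Finite B V₁]
      (V₂ : Type u) [AddCommGroup V₂] [Module ℝ V₂] [Module B V₂] [IsScalarTower ℝ B V₂] [Module.Finite B V₂]
      (φ₁ : LinearMap.BilinForm ℝ V₁) (φ₂ : LinearMap.BilinForm ℝ V₂),
      IsPosDefHermitianForm B V₁ ι φ₁ → IsPosDefHermitianForm B V₂ ι φ₂ →
        ((∃ e : V₁ ≃ₗ[B] V₂, ∀ v w : V₁, φ₂ (e v) (e w) = φ₁ v w) ↔ Nonempty (V₁ ≃ₗ[B] V₂))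

/-- **Lemma 2.7** (p. 381): «For all `b ∈ B` there are equalities `tr_{B/ℝ} b = tr_{B^opp/ℝ} b = tr_{B/ℝ} b*`.»
(`tr_{B^opp/ℝ} b` = trace of left multiplication by `b` on `Bᵐᵒᵖ` = of right multiplication on `B`; the
first equality uses that `B` is semisimple.) [cite: Kottwitz1992, Lemma 2.7 (p. 381)] -/
def Kottwitz1992_2_7_trace_eq : Prop :=
  IsAlgebraWithInvolution B ι → ∀ b : B,
    leftMulTrace ℝ B b = leftMulTrace ℝ Bᵐᵒᵖ (MulOpposite.op b) ∧ leftMulTrace ℝ B b = leftMulTrace ℝ B (ι b)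

/-- §2, remark after the Notation (p. 381, unnumbered): «we get an isomorphism from `B` to the real vector
space of all bilinear forms `(x, y)` on `B` such that `(bx, y) = (x, b*y)` …  Using Lemma 2.7 we see that
`(x, y)_b` is symmetric (respectively, alternating) if and only if `b` is symmetric (respectively,
antisymmetric, that is, `b* = -b`).  It is easy to see that `(x, y)_b` is nondegenerate if and only if `b` is an
invertible element of `B`.» [cite: Kottwitz1992, §2 (p. 381)] -/
def Kottwitz1992_2_trForm_symm_alt_nondegenerate : Prop :=
  IsAlgebraWithInvolution B ι → ∀ b : B,
    ((∀ x y : B, trForm ι b x y = trForm ι b y x) ↔ ι b = b) ∧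
    ((∀ x : B, trForm ι b x x = 0) ↔ ι b = -b) ∧
    ((∀ x : B, (∀ y : B, trForm ι b x y = 0) → x = 0) ↔ IsUnit b)

/-- **Lemma 2.8** (p. 381): «Suppose that `*` is a positive involution of `B`.  Then `B₊` is a nonempty open
convex cone in `B_sym`.  Moreover the group `B^×` acts transitively on `B₊`, the action of `b ∈ B^×` on
`x ∈ B₊` being given by `x ↦ b x b*`.  Finally, the set `B₊` is equal to `{b b* | b ∈ B^×}`.»  («Open in
`B_sym`»: for the module topology of the finite-dimensional real vector space `B`, in the subspace `B_sym`.)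
[cite: Kottwitz1992, Lemma 2.8 (p. 381)] -/
def Kottwitz1992_2_8_posElts_cone_transitive : Prop :=
  IsAlgebraWithInvolution B ι → IsPositiveInvolution B ι →
    (posElts ι).Nonempty ∧
    (∀ [TopologicalSpace B] [IsModuleTopology ℝ B], IsOpen {x : symSubmodule ι | (x : B) ∈ posElts ι}) ∧
    Convex ℝ (posElts ι) ∧ (∀ (t : ℝ) (x : B), 0 < t → x ∈ posElts ι → t • x ∈ posElts ι) ∧
    (∀ (b : Bˣ) (x : B), x ∈ posElts ι → unitsAct ι b x ∈ posElts ι) ∧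
    (∀ x ∈ posElts ι, ∀ y ∈ posElts ι, ∃ b : Bˣ, unitsAct ι b x = y) ∧
    posElts ι = {x | ∃ b : Bˣ, x = (b : B) * ι b}

/-- **Lemma 2.9** (p. 381): «Suppose that `*` is a positive involution leaving stable a semisimple subalgebra
`C` of `B`.  Then `C₊ = C ∩ B₊`.»  (Stable subalgebra presented by an injective intertwining `ℝ`-algebra map
`f : C → B`: `f(C₊) = f(C) ∩ B₊`.) [cite: Kottwitz1992, Lemma 2.9 (p. 381)] -/
def Kottwitz1992_2_9_posElts_subalgebra (C : Type u) [Ring C] [Algebra ℝ C] (ιC : C →ₗ[ℝ] C)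
    (f : C →ₐ[ℝ] B) : Prop :=
  IsAlgebraWithInvolution B ι → IsPositiveInvolution B ι → IsSemisimpleRing C → Function.Injective f →
    (∀ c : C, f (ιC c) = ι (f c)) → f '' posElts ιC = Set.range f ∩ posElts ι

/-- **Lemma 2.10** (p. 382), for finite-dimensional semisimple `ℝ`-algebras `(B, *_B)`, `(C, *_C)` with
positive involution: «Any homomorphism `i` from `B` to `C` is conjugate under `C^×` to a `*`-homomorphism.  If
two `*`-homomorphisms `i₁, i₂` from `B` to `C` are conjugate under `C^×`, then they are conjugate by an element
`c` of `C` satisfying `c c* = 1`.» [cite: Kottwitz1992, Lemma 2.10 (p. 382)] -/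
def Kottwitz1992_2_10_starHom_conjugacy (C : Type u) [Ring C] [Algebra ℝ C] (ιC : C →ₗ[ℝ] C) : Prop :=
  IsAlgebraWithInvolution B ι → IsPositiveInvolution B ι →
    IsAlgebraWithInvolution C ιC → IsPositiveInvolution C ιC →
    (∀ i : B →ₐ[ℝ] C, ∃ (c : Cˣ) (j : B →ₐ[ℝ] C), IsStarHom ι ιC j ∧ ∀ b : B, j b = c * i b * ↑c⁻¹) ∧
    (∀ i₁ i₂ : B →ₐ[ℝ] C, IsStarHom ι ιC i₁ → IsStarHom ι ιC i₂ →
      (∃ c : Cˣ, ∀ b : B, i₂ b = c * i₁ b * ↑c⁻¹) →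
        ∃ c : Cˣ, (c : C) * ιC c = 1 ∧ ∀ b : B, i₂ b = c * i₁ b * ↑c⁻¹)

/-- **Lemma 2.11** (p. 382): «Let `*`, `!` be two positive involutions on `B`.  Then there exists `b ∈ B^×` such
that `Int(b)` is a `*`-homomorphism from `(B, !)` to `(B, *)`.  Moreover we have `x^! = c⁻¹ x* c` for the
element `c = b* b`.» (`ι` = `*`, `τ` = `!`; `Int(b) x = b x b⁻¹`; the last identity is recorded as
`c x^! = x* c`, equivalent since `c = b* b` is invertible.) [cite: Kottwitz1992, Lemma 2.11 (p. 382)] -/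
def Kottwitz1992_2_11_two_positive_involutions (τ : B →ₗ[ℝ] B) : Prop :=
  IsAlgebraWithInvolution B ι → IsPositiveInvolution B ι → IsPositiveInvolution B τ →
    ∃ b : Bˣ, (∀ x : B, (b : B) * τ x * ↑b⁻¹ = ι ((b : B) * x * ↑b⁻¹)) ∧
      ∀ x : B, (ι b * b) * τ x = ι x * (ι b * b)

/-! REMARK closing §2 (p. 382): «The standard involutions on `M_n(ℝ)`, `M_n(ℂ)`, `M_n(ℍ)` are positive.  This
fact, together with Lemmas 2.4 and 2.11, shows that every semisimple algebra with positive involution is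
isomorphic to a product of these standard examples.» — not restated: for SIMPLE `B` this is the tree's PROVED
`Literature.RingTheory.CentralSimple.exists_algEquiv_matrix_forall_apply_eq` (Lange 2023, Lemma 2.6.3;
PositiveInvolutionQuaternionMatrices.lean §7, with `re_trace_conjTranspose_mul_self_pos` for the positivity of
`ᵗ‾` on `M_n(ℍ)`), and the reduction to the simple case is Lemma 2.4 above. -/

end Facts

end Literature.NumberTheory.Kottwitz1992.Involutions
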